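import Literature.NumberTheory.DiophantineGeometry.GenEllImagePoints
import Literature.NumberTheory.DiophantineGeometry.GenEllRootHeights
import Literature.NumberTheory.DiophantineGeometry.GenEllNorthcott
import HarnessLib

/-!
# [GenEll] Thm. 2.1, proof: transferring the Vojta inequality along a finite map `γ : ℙ¹ → ℙ¹`
# whose reduced pullback of the cusps is small (cusp-preserving Belyi maps)

S. Mochizuki, *Arithmetic elliptic curves in general position*, Math. J. Okayama Univ. 52 (2010)
[cite: MochizukiGenEll2010, Thm 2.1 pp.11–13]. The proof of Thm. 2.1 (p. 13) pulls the inequality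
`ht_{ω(C)} ≲ (1+ε)(log-diff + log-cond_C)` back along a finite map `φ` using Prop. 1.7 (i) (left:
`log-diff + log-cond_C` at `φ(y)` is at most `log-diff + log-cond_{φ⁻¹C}` at `y`), Prop. 1.6
(`log-cond_E ≲ ht_E`) and the functoriality of heights (Prop. 1.4 (i), (iii): `ht(φ(y)) ≈ deg φ · ht(y)`).
For `φ = γ : ℙ¹ → ℙ¹` of degree `n` the books balance exactly when the REDUCED pullback `γ⁻¹(C)_red`
is `C + B` with `deg B ≤ n − 1`, i.e. `γ({0,1,∞}) ⊆ {0,1,∞}` and `|γ⁻¹{0,1,∞}| = n + 2` (a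
cusp-preserving Belyi map, Riemann–Hurwitz): then Vojta with `ε` at the points `γ(x)` gives Vojta with
`(1+ε)/(1 − ε(n−1)) − 1` at the points `x`. This file PROVES that transfer in the tree's vocabulary
(`GenEllProjLine`, `GenEllThm21.VojtaIneq`; engines: abc-iut-S4's `GenEllPullbackConductor` = Prop. 1.7
(i) left for `ℙ¹ → ℙ¹`, `GenEllDivisorConductor` = Prop. 1.6 for `(ℙ¹, V(M))`; `GenEllImagePoints` =
re-presentation of `γ(x)` over `ℚ(γ(x))`):

* `ReducedPullback φ` — algebraic certificate that `rad(f·g·(f−g))` divides `t(t−1)·m_B` up to an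
  integer constant `c` (as forms: `f g (f−g) · h = c · ((t²−t)·m_B)^k` with the degree bookkeeping at `∞`),
  for `γ = f/g` an abc-iut-S4 `P1FiniteMap`;
* `condSupportDiv_pullbackCusps_subset` — off the primes dividing `c`, a point meets `γ*C` only where it
  meets `C` or `B`; hence `logCondDiv_pullbackCusps_le`:
  `log-cond_{γ*C}(x) ≤ log-cond_C(x) + log-cond_B(x) + log|c|`;
* (`GenEllRootHeights.exists_ht_le_of_aeval_eq_zero`) the finitely many algebraic numbers on `γ⁻¹(C)`
  have bounded absolute height (roots of a fixed integer polynomial);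
* `bdLe_transfer` / `vojtaIneq_transfer` — **the transfer**: if Vojta with `ε` holds on a set `T` of
  points in degree `≤ d`, then on the set of points `x` of degree `≤ d` whose image `γ(x)` (re-presented
  over `ℚ(γ(x))`) lies in `T`, `(n − (1+ε)·deg B)·ht ≤ (1+ε)(log-diff + log-cond_C) + O(1)`, i.e. Vojta
  with `(1+ε)/(n − (1+ε) deg B) − 1`, given the height lower bound `n·ht(x) ≤ ht(γ(x)) + O(1)`
  (hypothesis `hlow`; for a genuine degree-`n` map it is Silverman AEC VIII.5.6 / the tree's
  `ProjectiveMorphismHeight`, and for `x ↦ x^p` it is Mathlib's `logHeight₁_pow` — see the instance files).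

abc-iut cell, route item GenEllTwo (stmt-ABC-19679), work package W2 of the ℙ¹-route; classical and
undisputed; nothing here bears on [IUTchIII] Cor. 3.12.
-/

noncomputable section

open NumberField IsDedekindDomain Height Polynomial

namespace Literature.NumberTheory.DiophantineGeometry.GenEll

/-! ## Values of a finite map and the reduced-pullback certificate -/

namespace P1FiniteMap

/-- The value `γ(x) = f(x)/g(x)` of the finite map at an affine point (junk `0` where `g(x) = 0`).
[cite: MochizukiGenEll2010, Prop 1.7 p.9] -/
def eval (φ : P1FiniteMap) {F : Type*} [Field F] (x : F) : F := aeval x φ.num / aeval x φ.den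

/-- The set of presented points whose `γ`-image, re-presented over its minimal field `ℚ(γ(x))`, lies in
`T` (points on `γ⁻¹(C)` are included vacuously: their height is bounded, `exists_ht_le_of_aeval_eq_zero`).
[cite: MochizukiGenEll2010, Thm 2.1 p.13] -/
def preimageSet (φ : P1FiniteMap) (T : Set NFPoint) : Set NFPoint :=
  {P | P.OffDiv φ.pullbackCusps → P.imageAt (φ.eval P.x) ∈ T}

end P1FiniteMap

/-- CERTIFICATE that the reduced pullback `γ⁻¹(C)_red` of `C = [0]+[1]+[∞]` under `γ = f/g` is
(contained in) `C + B`, `B = V(m_B)`: an identity of integer polynomials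
`f·g·(f−g)·h = c·((t²−t)·m_B)^k` (`c ≠ 0`, `k ≥ 1`) whose degree bookkeeping
`deg h + 3n ≤ k·(3 + deg B)` accounts for the point `∞` (form degrees: `γ*C` has degree `3n`, `C` degree
`3`, `B` degree `deg B`), together with `m_B ∣ (f g (f−g))^j` (so `B ⊆ γ⁻¹(C)`) and non-degeneracy.
For a cusp-preserving Belyi map of degree `n` one can take `deg B = n − 1` (Riemann–Hurwitz:
`|γ⁻¹{0,1,∞}| = n + 2`). [cite: MochizukiGenEll2010, Prop 1.7 p.9] -/
structure ReducedPullback (φ : P1FiniteMap) where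
  /-- the residual divisor `B = V(m_B)`, `γ⁻¹(C)_red = C ∪ B` -/
  B : P1Divisor
  /-- exponent `k ≥ 1` -/
  k : ℕ
  one_le_k : 1 ≤ k
  /-- the integer constant `c ≠ 0` (its prime divisors are the exceptional primes) -/
  c : ℤ
  c_ne_zero : c ≠ 0
  /-- the cofactor `h` -/
  h : ℤ[X]
  /-- `f g (f − g) · h = c · ((t² − t) · m_B)^k` -/
  hdiv : φ.num * φ.den * (φ.num - φ.den) * h = C c * ((X ^ 2 - X) * B.poly) ^ k
  /-- degree bookkeeping at `∞`: `deg h + 3n ≤ k (3 + deg B)` -/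
  hdeg : h.natDegree + 3 * φ.deg ≤ k * (3 + B.deg)
  /-- `B ⊆ γ⁻¹(C)`: `m_B ∣ (f g (f−g))^j` -/
  j : ℕ
  hBdiv : B.poly ∣ (φ.num * φ.den * (φ.num - φ.den)) ^ j
  /-- non-degeneracy: `f g (f − g) ≠ 0` -/
  ne_zero : φ.num * φ.den * (φ.num - φ.den) ≠ 0

namespace P1Divisor

/-- The "constant divisor" `V(c)`, `c ∈ ℤ`: empty over `ℚ`, its conductor support at a point is the
set of primes dividing `c` (the exceptional primes of a reduced-pullback certificate); an instance of
[GenEll] Def. 1.5 (iv)'s `D = V(M)` with `deg M = 0`. [cite: MochizukiGenEll2010, Def 1.5 (iv) p.8] -/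
def const (c : ℤ) : P1Divisor where
  poly := C c
  deg := 0
  natDegree_le := by rw [natDegree_C]

/-- `‖c‖₁ = |c|` (the constant of Prop. 1.6 for `V(c)`). [cite: MochizukiGenEll2010, Prop 1.6 p.9] -/
theorem coeffSum_const (c : ℤ) : (const c).coeffSum = |(c : ℝ)| := by
  simp [coeffSum, const]

end P1Divisor

namespace NFPoint

/-- A point is off `V(c)` as soon as `c ≠ 0` (`V(c)` has no `Q̄`-points). [cite: MochizukiGenEll2010, Def 1.5 (iv) p.8] -/
theorem offDiv_const (P : NFPoint) {c : ℤ} (hc : c ≠ 0) : P.OffDiv (P1Divisor.const c) := by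
  simp only [OffDiv, P1Divisor.const, map_intCast, eq_intCast, ne_eq, Int.cast_eq_zero]
  exact hc

/-- `log-cond_{V(c)}(x) ≤ log |c|` ([GenEll] Prop. 1.6 for the degree-`0` divisor `V(c)`).
[cite: MochizukiGenEll2010, Prop 1.6 p.9] -/
theorem logCondDiv_const_le (P : NFPoint) {c : ℤ} (hc : c ≠ 0) :
    P.logCondDiv (P1Divisor.const c) ≤ Real.log |(c : ℝ)| := by
  have h := P.logCondDiv_le (P.offDiv_const hc)
  rw [P1Divisor.coeffSum_const] at h
  simpa [P1Divisor.const] using h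

/-! ## The conductor at `γ*C` versus the conductors at `C` and `B` -/

variable {φ : P1FiniteMap} (R : ReducedPullback φ)

/-- Off `γ⁻¹(C)` a point is off `B` (`m_B ∣ (f g (f−g))^j`, i.e. `B ⊆ γ⁻¹(C)`).
[cite: MochizukiGenEll2010, Prop 1.7 p.9] -/
theorem offDiv_B (P : NFPoint) (hP : P.OffDiv φ.pullbackCusps) : P.OffDiv R.B := by
  intro h0
  apply hP
  obtain ⟨q, hq⟩ := R.hBdiv
  have : aeval P.x ((φ.num * φ.den * (φ.num - φ.den)) ^ R.j) = 0 := by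
    rw [hq, map_mul, h0, zero_mul]
  rw [map_pow] at this
  exact pow_eq_zero_iff'.mp this |>.1 |> fun h => by
    simpa [OffDiv, P1FiniteMap.pullbackCusps] using h

/-- **Support comparison**: a prime at which `x` meets `γ*C` is a prime at which `x` meets `C`, or
meets `B`, or divides `c` — the reduced pullback `γ⁻¹(C)_red ⊆ C ∪ B` away from the exceptional
primes. In `w`-adic absolute values: if `|t²−t|_w = M³`, `|m_B|_w = M^{deg B}` and `|c|_w = 1`
(`M = max(|x|_w,1)`), the identity `f g (f−g)·h = c·((t²−t) m_B)^k` and `|h|_w ≤ M^{deg h}` give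
`|f g (f−g)|_w ≥ M^{k(3+deg B) − deg h} ≥ M^{3n}`. [cite: MochizukiGenEll2010, Prop 1.7 (i) p.9] -/
theorem condSupportDiv_pullbackCusps_subset (P : NFPoint) :
    P.condSupportDiv φ.pullbackCusps ⊆
      P.condSupport ∪ P.condSupportDiv R.B ∪ P.condSupportDiv (P1Divisor.const R.c) := by
  intro w hw
  rw [← condSupportDiv_cusps]
  by_contra hnot
  simp only [Set.mem_union, not_or] at hnot
  obtain ⟨⟨hC, hB⟩, hc⟩ := hnot
  rw [mem_condSupportDiv_iff_mk] at hw hC hB hc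
  set μ := FinitePlace.mk w with hμ
  set M : ℝ := max (μ P.x) 1 with hM
  have hM1 : 1 ≤ M := le_max_right _ _
  have hM0 : 0 < M := lt_of_lt_of_le zero_lt_one hM1
  -- the three non-strict bounds, hence equalities
  have hCle : μ (aeval P.x P1Divisor.cusps.poly) ≤ M ^ 3 :=
    finitePlace_aeval_le μ _ P1Divisor.cusps.natDegree_le P.x
  have hBle : μ (aeval P.x R.B.poly) ≤ M ^ R.B.deg :=
    finitePlace_aeval_le μ _ R.B.natDegree_le P.x
  have hcle : μ (aeval P.x (P1Divisor.const R.c).poly) ≤ M ^ (P1Divisor.const R.c).deg :=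
    finitePlace_aeval_le μ _ (P1Divisor.const R.c).natDegree_le P.x
  have hCeq : μ (aeval P.x P1Divisor.cusps.poly) = M ^ 3 := le_antisymm hCle (not_lt.mp hC)
  have hBeq : μ (aeval P.x R.B.poly) = M ^ R.B.deg := le_antisymm hBle (not_lt.mp hB)
  have hceq : μ (aeval P.x (C R.c : ℤ[X])) = 1 := by
    have := le_antisymm hcle (not_lt.mp hc)
    simpa [P1Divisor.const] using this
  -- `|h(x)|_w ≤ M^{deg h}`
  have hhle : μ (aeval P.x R.h) ≤ M ^ R.h.natDegree := finitePlace_aeval_le μ _ le_rfl P.x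
  -- evaluate the certificate at `x`
  have hid := congrArg (aeval P.x) R.hdiv
  simp only [map_mul, map_pow] at hid
  -- `|c ((t²−t) m_B)^k (x)|_w = M^{k(3 + deg B)}`
  have hrhs : μ (aeval P.x (C R.c : ℤ[X]) * (aeval P.x (X ^ 2 - X : ℤ[X]) * aeval P.x R.B.poly) ^ R.k)
      = M ^ (R.k * (3 + R.B.deg)) := by
    have hcusp : aeval P.x (X ^ 2 - X : ℤ[X]) = aeval P.x P1Divisor.cusps.poly := rfl
    rw [map_mul μ, map_pow μ, map_mul μ, hceq, one_mul, hcusp, hCeq, hBeq, ← pow_add, ← pow_mul,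
      mul_comm]
  -- `|f g (f−g)(x)|_w · |h(x)|_w < M^{3n} · M^{deg h} ≤ M^{k(3+deg B)}`
  have hlhs : μ (aeval P.x φ.num * aeval P.x φ.den * aeval P.x (φ.num - φ.den) *
      aeval P.x R.h) < M ^ (R.k * (3 + R.B.deg)) := by
    have h1 : μ (aeval P.x φ.pullbackCusps.poly) < M ^ (3 * φ.deg) := hw
    have hpoly : aeval P.x φ.pullbackCusps.poly =
        aeval P.x φ.num * aeval P.x φ.den * aeval P.x (φ.num - φ.den) := by
      simp only [P1FiniteMap.pullbackCusps, map_mul]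
    rw [map_mul μ, ← hpoly]
    calc μ (aeval P.x φ.pullbackCusps.poly) * μ (aeval P.x R.h)
        < M ^ (3 * φ.deg) * M ^ R.h.natDegree := by
          rcases eq_or_lt_of_le (apply_nonneg μ (aeval P.x R.h)) with h0 | hpos
          · rw [← h0, mul_zero]; positivity
          · exact mul_lt_mul h1 hhle hpos (by positivity)
      _ = M ^ (R.h.natDegree + 3 * φ.deg) := by rw [← pow_add, add_comm]
      _ ≤ M ^ (R.k * (3 + R.B.deg)) := pow_le_pow_right₀ hM1 R.hdeg
  rw [hid] at hlhs
  exact absurd hrhs (ne_of_lt hlhs)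


/-- `Σ_{s ∪ t} f ≤ Σ_s f + Σ_t f` for nonnegative `f`. [folklore] -/
private theorem sum_union_le {ι : Type*} [DecidableEq ι] (s t : Finset ι) (f : ι → ℝ)
    (hf : ∀ i, 0 ≤ f i) : ∑ i ∈ s ∪ t, f i ≤ ∑ i ∈ s, f i + ∑ i ∈ t, f i := by
  rw [← Finset.sum_union_inter]
  linarith [Finset.sum_nonneg (fun i (_ : i ∈ s ∩ t) => hf i)]

/-- **`log-cond_{γ*C}(x) ≤ log-cond_C(x) + log-cond_B(x) + log |c|`** for a point `x ∈ U` off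
`γ⁻¹(C)`: the conductor of the (non-reduced, degree-`3n`) pullback divisor only sees the support
`γ⁻¹(C)_red ⊆ C ∪ B` plus the primes dividing `c`, which contribute at most `log |c|`
([GenEll] Def. 1.5 (iv): "`(D_x)_red`"). [cite: MochizukiGenEll2010, Prop 1.7 (i) p.9] -/
theorem logCondDiv_pullbackCusps_le (P : NFPoint) (hP : P.OffDiv φ.pullbackCusps) (hU : P.InU) :
    P.logCondDiv φ.pullbackCusps ≤ P.logCond + P.logCondDiv R.B + Real.log |(R.c : ℝ)| := by
  classical
  have hB : P.OffDiv R.B := P.offDiv_B R hP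
  have hc : P.OffDiv (P1Divisor.const R.c) := P.offDiv_const R.c_ne_zero
  have hconst := P.logCondDiv_const_le R.c_ne_zero
  rw [P.logCondDiv_eq_sum hc] at hconst
  rw [P.logCondDiv_eq_sum hP, P.logCond_eq_sum hU, P.logCondDiv_eq_sum hB]
  set f : HeightOneSpectrum (𝓞 P.F) → ℝ := fun w => Real.log (Ideal.absNorm w.asIdeal : ℝ) with hf
  have hf0 : ∀ w, 0 ≤ f w := fun w => Real.log_nonneg (by
    exact_mod_cast Nat.one_le_iff_ne_zero.mpr (by rw [Ne, Ideal.absNorm_eq_zero_iff]; exact w.ne_bot))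
  have hd : 0 ≤ (P.degree : ℝ)⁻¹ := inv_nonneg.mpr (Nat.cast_nonneg _)
  set S := (P.condSupportDiv_finite hP).toFinset
  set S₁ := (P.condSupport_finite hU).toFinset
  set S₂ := (P.condSupportDiv_finite hB).toFinset
  set S₃ := (P.condSupportDiv_finite hc).toFinset
  have hsub : S ⊆ S₁ ∪ S₂ ∪ S₃ := by
    intro w hw
    have hw' : w ∈ P.condSupportDiv φ.pullbackCusps := (Set.Finite.mem_toFinset _).mp hw
    have := P.condSupportDiv_pullbackCusps_subset R hw'
    simp only [S₁, S₂, S₃, Finset.mem_union, Set.Finite.mem_toFinset]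
    simpa only [Set.mem_union] using this
  have hsum : ∑ w ∈ S, f w ≤ ∑ w ∈ S₁, f w + ∑ w ∈ S₂, f w + ∑ w ∈ S₃, f w :=
    calc ∑ w ∈ S, f w ≤ ∑ w ∈ S₁ ∪ S₂ ∪ S₃, f w :=
          Finset.sum_le_sum_of_subset_of_nonneg hsub fun w _ _ => hf0 w
      _ ≤ ∑ w ∈ S₁ ∪ S₂, f w + ∑ w ∈ S₃, f w := sum_union_le _ _ f hf0
      _ ≤ ∑ w ∈ S₁, f w + ∑ w ∈ S₂, f w + ∑ w ∈ S₃, f w := by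
          linarith [sum_union_le S₁ S₂ f hf0]
  have := mul_le_mul_of_nonneg_left hsum hd
  linarith

/-! ## The transfer -/

/-- "`y ↦ γ(y)`" in abc-iut-S4's `MapsUnder` form, for the re-presented image point: the point `P` is
presented over the extension `ℚ(γ(x)) ⊆ F` of the field of `γ(P) = P.imageAt (γ x)`, with
`f(x) = γ(x)·g(x)`. [cite: MochizukiGenEll2010, Prop 1.7 p.9] -/
theorem mapsUnder_imageAt (P : NFPoint) (hP : P.OffDiv φ.pullbackCusps) :
    MapsUnder φ (P.imageAt (φ.eval P.x)) P (P.imageEmb (φ.eval P.x)) := by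
  have hg : aeval P.x φ.den ≠ 0 := by
    intro h; apply hP; simp [P1FiniteMap.pullbackCusps, h]
  refine ⟨hg, ?_⟩
  rw [imageEmb_x, P1FiniteMap.eval, div_mul_cancel₀ _ hg]

/-- Off `γ⁻¹(C)` the value `γ(x)` is `≠ 0, 1` (and `g(x) ≠ 0`). [cite: MochizukiGenEll2010, Prop 1.7 p.9] -/
theorem eval_ne_of_offDiv (P : NFPoint) (hP : P.OffDiv φ.pullbackCusps) :
    φ.eval P.x ≠ 0 ∧ φ.eval P.x ≠ 1 := by
  have h : aeval P.x φ.num * aeval P.x φ.den * (aeval P.x φ.num - aeval P.x φ.den) ≠ 0 := by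
    simpa [OffDiv, P1FiniteMap.pullbackCusps] using hP
  have hf : aeval P.x φ.num ≠ 0 := fun h0 => h (by rw [h0]; ring)
  have hg : aeval P.x φ.den ≠ 0 := fun h0 => h (by rw [h0]; ring)
  have hfg : aeval P.x φ.num - aeval P.x φ.den ≠ 0 := fun h0 => h (by rw [h0]; ring)
  refine ⟨div_ne_zero hf hg, fun h1 => hfg ?_⟩
  rw [P1FiniteMap.eval, div_eq_one_iff_eq hg] at h1
  rw [h1, sub_self]

/-- **TRANSFER OF THE VOJTA INEQUALITY ALONG `γ` (raw form).** Let `γ = f/g : ℙ¹ → ℙ¹` of degree `n`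
carry a reduced-pullback certificate with residual divisor `B`, and satisfy the height lower bound
`n·ht(x) ≤ ht(γ(x)) + C_γ` (`hlow`, absolute heights; Prop. 1.4 (i), (iii)). If on a set `T` of points
the inequality `ht ≲ (1+ε)(log-diff + log-cond_C)` holds in degree `≤ d` (`VojtaIneq T d ε`), then on
the points of degree `≤ d` whose `γ`-image lies in `T`:
`(n − (1+ε)·deg B)·ht ≲ (1+ε)·(log-diff + log-cond_C)`.
Bookkeeping ([GenEll] p. 13 with Props. 1.4, 1.6, 1.7 (i)): `n·ht(x) − C_γ ≤ ht(γx) ≤ (1+ε)(log-diff +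
log-cond_C)(γx) + C_T ≤ (1+ε)(log-diff(x) + log-cond_{γ*C}(x)) + C_T ≤ (1+ε)(log-diff(x) + log-cond_C(x)
+ deg B·ht(x) + log‖m_B‖₁ + log|c|) + C_T`; the points on `γ⁻¹(C)` have bounded height.
[cite: MochizukiGenEll2010, Thm 2.1 p.13] -/
theorem bdLe_transfer {Cφ : ℝ}
    (hlow : ∀ P : NFPoint, P.OffDiv φ.pullbackCusps →
      (φ.deg : ℝ) * P.ht ≤ (P.degree : ℝ)⁻¹ * logHeight₁ (φ.eval P.x) + Cφ)
    {T : Set NFPoint} {d : ℕ} {ε : ℝ} (hε : 0 ≤ ε) (hV : VojtaIneq T d ε) :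
    BDLe (φ.preimageSet T ∩ UPle d) (fun P => ((φ.deg : ℝ) - (1 + ε) * R.B.deg) * P.ht)
      (fun P => (1 + ε) * (P.logDiff + P.logCond)) := by
  obtain ⟨CT, hCT⟩ := hV
  obtain ⟨Hexc, hHexc⟩ := exists_ht_le_of_aeval_eq_zero _ R.ne_zero
  set L : ℝ := Real.log R.B.coeffSum + Real.log |(R.c : ℝ)| with hL
  refine ⟨max (Cφ + (1 + ε) * L + CT) (|(φ.deg : ℝ) - (1 + ε) * R.B.deg| * Hexc), fun P hP => ?_⟩
  obtain ⟨hpre, hPd⟩ := hP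
  have hU : P.InU := hPd.1.1
  by_cases hoff : P.OffDiv φ.pullbackCusps
  · -- the generic case: `x ∉ γ⁻¹(C)`
    refine le_trans ?_ (le_max_left _ _)
    set Q := P.imageAt (φ.eval P.x) with hQ
    have hQT : Q ∈ T := hpre hoff
    obtain ⟨h0, h1⟩ := P.eval_ne_of_offDiv hoff
    have hQd : Q ∈ UPle d := P.imageAt_mem_UPle h0 h1 hPd.2
    -- Vojta at `γ(x)`
    have hVQ : Q.ht - (1 + ε) * (Q.logDiff + Q.logCond) ≤ CT := hCT Q ⟨hQT, hQd⟩
    -- height: `n ht(x) ≤ ht(γ x) + Cφ`, `ht(γ x) = ht Q`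
    have hhtQ : Q.ht = (P.degree : ℝ)⁻¹ * logHeight₁ (φ.eval P.x) := P.ht_imageAt _
    have hh : (φ.deg : ℝ) * P.ht ≤ Q.ht + Cφ := by rw [hhtQ]; exact hlow P hoff
    -- Prop. 1.7 (i) left + Prop. 1.6 for `B` + the constant divisor
    have h17 : Q.logCond - P.logCondDiv φ.pullbackCusps ≤ P.logDiff - Q.logDiff :=
      logCond_sub_logCondDiv_le (P.mapsUnder_imageAt hoff) ((P.imageAt_inU_iff _).mpr ⟨h0, h1⟩)
    have hcond := P.logCondDiv_pullbackCusps_le R hoff hU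
    have h16 : P.logCondDiv R.B ≤ R.B.deg * P.ht + Real.log R.B.coeffSum :=
      P.logCondDiv_le (P.offDiv_B R hoff)
    have hε1 : 0 ≤ 1 + ε := by linarith
    have key : Q.logDiff + Q.logCond ≤ P.logDiff + P.logCond + R.B.deg * P.ht + L := by
      rw [hL]; linarith
    have := mul_le_mul_of_nonneg_left key hε1
    nlinarith
  · -- the exceptional case: `x ∈ γ⁻¹(C)`, bounded height
    refine le_trans ?_ (le_max_right _ _)
    have hroot : aeval P.x (φ.num * φ.den * (φ.num - φ.den)) = 0 := not_not.mp hoff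
    have hht : P.ht ≤ Hexc := hHexc P hroot
    have hht0 : 0 ≤ P.ht := P.ht_nonneg
    have hrhs : 0 ≤ (1 + ε) * (P.logDiff + P.logCond) :=
      mul_nonneg (by linarith) (add_nonneg P.logDiff_nonneg P.logCond_nonneg)
    have habs : ((φ.deg : ℝ) - (1 + ε) * R.B.deg) * P.ht ≤ |(φ.deg : ℝ) - (1 + ε) * R.B.deg| * Hexc :=
      calc ((φ.deg : ℝ) - (1 + ε) * R.B.deg) * P.ht ≤ |(φ.deg : ℝ) - (1 + ε) * R.B.deg| * P.ht :=
            mul_le_mul_of_nonneg_right (le_abs_self _) hht0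
        _ ≤ |(φ.deg : ℝ) - (1 + ε) * R.B.deg| * Hexc := mul_le_mul_of_nonneg_left hht (abs_nonneg _)
    linarith

/-- **TRANSFER OF THE VOJTA INEQUALITY ALONG `γ`.** In the situation of `bdLe_transfer`, if
`(1+ε)·deg B < n`, then Vojta with `ε` on `T` in degree `≤ d` implies Vojta with
`ε' := (1+ε)/(n − (1+ε)·deg B) − 1` on the points whose `γ`-image lies in `T`, in degree `≤ d`. For a
cusp-preserving Belyi map (`deg B = n − 1`) this is `(1+ε)/(1 − ε(n−1)) − 1`, the loss factor of
[GenEll] Thm. 2.1's transfer step for `e = 1`. [cite: MochizukiGenEll2010, Thm 2.1 p.13] -/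
theorem vojtaIneq_transfer {Cφ : ℝ}
    (hlow : ∀ P : NFPoint, P.OffDiv φ.pullbackCusps →
      (φ.deg : ℝ) * P.ht ≤ (P.degree : ℝ)⁻¹ * logHeight₁ (φ.eval P.x) + Cφ)
    {T : Set NFPoint} {d : ℕ} {ε : ℝ} (hε : 0 ≤ ε) (ha : (1 + ε) * R.B.deg < φ.deg)
    (hV : VojtaIneq T d ε) :
    VojtaIneq (φ.preimageSet T) d ((1 + ε) / ((φ.deg : ℝ) - (1 + ε) * R.B.deg) - 1) := by
  obtain ⟨C, hC⟩ := bdLe_transfer R hlow hε hV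
  set a : ℝ := (φ.deg : ℝ) - (1 + ε) * R.B.deg with ha'
  have hapos : 0 < a := by rw [ha']; linarith
  refine ⟨C / a, fun P hP => ?_⟩
  have h := hC P hP
  have h1 : (1 + ((1 + ε) / a - 1)) = (1 + ε) / a := by ring
  rw [h1]
  have : P.ht - (1 + ε) / a * (P.logDiff + P.logCond) = (a * P.ht - (1 + ε) * (P.logDiff + P.logCond)) / a := by
    field_simp
  rw [this, div_le_div_iff_of_pos_right hapos]
  exact h

/-- The height lower bound `hlow` from a FIELD-UNIFORM relative bound
`n·h_K(x) ≤ h_K(γ(x)) + C·[K:ℚ]` (the form Silverman AEC VIII.5.6 / the tree's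
`ProjectiveMorphismHeight.exists_abs_logHeight_eval_sub_le_finrank` delivers).
[cite: SilvermanAEC2009, Thm VIII.5.6] -/
theorem hlow_of_relative {Cφ : ℝ}
    (h : ∀ (K : Type) [Field K] [NumberField K] (x : K), aeval x (φ.num * φ.den * (φ.num - φ.den)) ≠ 0 →
      (φ.deg : ℝ) * logHeight₁ x ≤ logHeight₁ (φ.eval x) + Cφ * Module.finrank ℚ K) :
    ∀ P : NFPoint, P.OffDiv φ.pullbackCusps →
      (φ.deg : ℝ) * P.ht ≤ (P.degree : ℝ)⁻¹ * logHeight₁ (φ.eval P.x) + Cφ := by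
  intro P hP
  have hP' : aeval P.x (φ.num * φ.den * (φ.num - φ.den)) ≠ 0 := by
    simpa [OffDiv, P1FiniteMap.pullbackCusps] using hP
  have hK := h P.F P.x hP'
  have hdeg : (0 : ℝ) < P.degree := Nat.cast_pos.mpr P.degree_pos
  have hdeg' : (Module.finrank ℚ P.F : ℝ) = P.degree := rfl
  unfold ht
  have hinv : 0 ≤ (P.degree : ℝ)⁻¹ := inv_nonneg.mpr hdeg.le
  have h2 := mul_le_mul_of_nonneg_left hK hinv
  have hC : (P.degree : ℝ)⁻¹ * (Cφ * P.degree) = Cφ := by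
    field_simp
  calc (φ.deg : ℝ) * ((P.degree : ℝ)⁻¹ * logHeight₁ P.x)
      = (P.degree : ℝ)⁻¹ * ((φ.deg : ℝ) * logHeight₁ P.x) := by ring
    _ ≤ (P.degree : ℝ)⁻¹ * (logHeight₁ (φ.eval P.x) + Cφ * Module.finrank ℚ P.F) := h2
    _ = (P.degree : ℝ)⁻¹ * logHeight₁ (φ.eval P.x) + Cφ := by rw [hdeg', mul_add, hC]

end NFPoint

end Literature.NumberTheory.DiophantineGeometry.GenEll

end
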